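import Literature.NumberTheory.EllipticCurves.Wuthrich2014.ReducibleDivisibilityCyclotomicPrimeHalf
import Summits.BirchSwinnertonDyer.Rank1Residual.X11a.LambdaNorm
import Summits.BirchSwinnertonDyer.Rank1Residual.X11a.MuLambdaSplit
import Literature.NumberTheory.EllipticCurves.PAdicBSD
import HarnessLib

/-!
# X3 on the semistable-twist locus: the `ω^{(p−1)/2}`-BRANCH main conjecture of the twist `E♭`
# (reducible `E♭[p]`) as "Greenberg–Vatsal ON THE BRANCH" — the `λ`-equality TYPED, the analytic
# `μ = 0` bit TYPED as a certificate, and the kernel equivalence with the branch equality granted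
# Wuthrich's half-eigen divisibility (cell `b2b-bsdres`, team n1011, OWNERS row T-c2x3)

HONEST FRAMING (cell `b2b-bsdres`, run/shared/lean/b2b/bsd-rank1-residual/, verbatim in every
file): the goal of the cell is to DELETE the COMBINATION-SHAPED residual classes of the
Birch–Swinnerton-Dyer formula for ALL analytic-rank `≤ 1` elliptic curves over `ℚ` — "full BSD
formula for every rank `≤ 1` curve in class `C`" assembled STRICTLY from published theorems — so
that the rank-`≤ 1` remainder becomes exactly the CONSTRUCTION-SHAPED classes, which are TYPED
(missing-input `Prop`s), NOT attempted. This is not "finishing BSD". Team n1011 (RESIDUAL-MAP §I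
N10, the LOWER half at an additive prime; X3 = additive `p`, `E[p]` REDUCIBLE), seat
`b2b-bsdres-n1011-p12`, row T-c2x3 (assigned by the lead, PLAN §2 T-c2 (iv)): research route on the
CONSTRUCTION-SHAPED class X3; labels and RESIDUAL-MAP marks UNCHANGED; nothing booked; NO Literature
fact minted (three typed items under `Summits/`, nothing asserted; the theorems compose ONE
PUBLISHED named fact of the tree, carried as an explicit binder).

## The object

Let `(E, p)` be an X3 pair on the semistable-twist locus (`SubSemistableTwist`: the quadratic twist
`E♭ := E ⊗ χ_{p*}`, `p* = (−1)^{(p−1)/2} p`, is SEMISTABLE at `p` — good ordinary on (G-ord, `e = 2`),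
multiplicative on (M)); `E♭[p] ≅ E[p] ⊗ χ_{p*}` is reducible. The LOWER half of `BSD(E,p)` lives on
the `ω^m`-branch, `m = (p−1)/2`, of the cyclotomic Iwasawa theory of `V := E♭` over `ℚ(μ_{p^∞})`
(additive-p2 AUDIT-X34-GORD R3/R9; lead's PLAN §1.2): with `X_m := e_m X(V/ℚ(μ_{p^∞}))` (the
`χ_{ℚ(√p*)}`-eigen Selmer dual, tree `EigenSelmerDualData`) and `B_m := L_p(V, ω^m, T)` (tree
`padicLFunction[Minus]Branch[Mult]` by parity / reduction type), the PUBLISHED half is Wuthrich, Doc.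
Math. 19 (2014) Thm. 16 (Kato's divisibility made integral at a reducible semistable prime), in the
tree as the named fact `Wuthrich2014.thm16_halfEigenCharIdeal_dvd_cyclotomicPrime`
(`∃ g' ∈ char X_m, ι g' = C(u·ϖ)·B_m`: "`char X_m ∣ (ϖ B_m)`"); the MISSING half is the reverse
divisibility, i.e. the EQUALITY `char_{Λ} X_m = (ϖ B_m)` — typed here as `X3BranchMainConjectureAt V p`.
Greenberg–Vatsal, Invent. Math. 142 (2000) p. 4: given the divisibility, the equality is the
conjunction of a `μ`-part and a `λ`-part ("the equality `λ_alg = λ_an` implies that `f_alg` and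
`f_an` differ by multiplication by a power of `p`. The further equality `μ_alg = μ_an` then implies
the Main Conjecture") — in the kernel for the trivial branch of an Eisenstein `E` as
`X1.MuLambda.mazurMainConjecture_iff_muPart_and_lambdaPart` (sub-cell eisenstein-p1). THIS FILE is
that dichotomy ON THE BRANCH `m`:

* `X3BranchLambdaEqAt V p` (TYPED, `@[conjecture]`): **Greenberg–Vatsal on the branch** — for every
  half-eigen datum and every factorisation `ι(g·h) = C(u ϖ) B_m` through a generator `g` of
  `char X_m`, if both `g` and `g·h` have unit content (`μ_alg = μ_an = 0`) then `λ(g·h) = λ(g)`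
  (`λ_an = λ_alg`; `λ` = eisenstein-p1's `X1.MuLambda.lam`, = the Weierstrass degree `normLam` at unit
  content by `lam_eq_normLam`). WHICH HALF OF GV §3 TRANSFERS (honest note): Greenberg–Vatsal,
  Thm. (1.3) (arXiv:math/9906215 pp. 4–5, verbatim in the tree's
  `GreenbergVatsal2000/IwasawaInvariants.lean`): "Assume that `E` is a modular elliptic curve over
  `ℚ`, and that `p` is an odd prime where `E` has good ordinary reduction. Assume also that `E` admits
  a `ℚ`-isogeny of degree `p` with kernel `Φ`, and that the action of `G_ℚ` on `Φ` is either ramified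
  at `p` and even, or unramified at `p` and odd. Then `λ_alg(E) = λ_anal(E)` and
  `μ_alg(E) = μ_anal(E) = 0`" — a statement for `E` ITSELF over `ℚ_∞`, i.e. the TRIVIAL branch; its
  §3 proof computes both sides from the characters of `Φ` and `E[p]/Φ` (Iwasawa theory of abelian
  fields: Ferrero–Washington for `μ = 0`, Mazur–Wiles for the characteristic series; the analytic side
  through the Eisenstein congruence with canonical periods, §3 Lemma (3.6) / Cor. (3.8)). On the
  branch `ω^m` the same computation would run with the characters twisted by `ω^m`, the parity /
  ramification hypothesis becoming the corresponding condition on the twisted character of `Φ` — but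
  NO printed statement does it on a branch `≠ 0` (Thm. (1.3)/(1.4) and the tree's
  `GreenbergVatsal2000.thm13_charIdeal_eq_of_gvPar` are over `ℚ_∞` only; additive-p2's
  AUDIT-X34-GORD R9: "NOT IN PRINT on that branch"). So BOTH halves of Thm. (1.3) — the `μ = 0`
  half and the `λ`-equality half — are UNPRINTED on the branch; here the `λ`-half is TYPED as a
  conjecture and the `μ`-half is NOT conjectured but carried as explicit per-pair binders,
  as the lead's row asks, and are per-pair CENSUS bits (instrument I-10 = PARI `ellpadiclambdamu`-type
  `λ/μ` engine on `E♭ ⊗ ω^m`; request line filed with the lead) — never facts.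
* `X3BranchAnalyticMuZeroAt V p` (TYPED): the analytic `μ = 0` bit — ONE coefficient of `ϖ·B_m` is a
  `p`-adic unit (certificate shape; under Wuthrich's fact it forces the algebraic `μ = 0` too).
* `X3BranchMainConjectureAt V p` (TYPED, `@[conjecture]`): the branch equality.
* KERNEL (§2): `x3BranchMainConjectureAt_of_lambdaEq_of_muZero` — Wuthrich's fact ∧ `λ`-equality ∧
  analytic `μ = 0` ⟹ the branch main conjecture (GV p. 4 on the branch; pure algebra of `Λ` from
  `X1/MuLambdaAlgebra.lean`: `span_eq_span_iff_mu_le_and_lam_le`); conversely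
  `x3BranchLambdaEqAt_of_mainConjecture` (the `λ`-equality is NECESSARY); and the reversed
  divisibility `dvd_of_mem_charIdeal_of_x3BranchMainConjectureAt` (every element of `char X_m` is a
  multiple of `g'` with `ι g' = C(uϖ)B_m`) — the X3 input that row T-c2 (seat p10) reduces to the
  `T = 0` lower inputs of rows T-N10-low / T-N10b / T-N10M and thence to `Typed.MissingLowerBoundAt W p`
  for the additive twist `W = E` (NOT re-derived here).

Nothing here is a class theorem; X3 stays CONSTRUCTION-SHAPED. References: Greenberg–Vatsal 2000
[GreenbergVatsal2000] Thm. (1.3), §3, p. 4; Wuthrich 2014 [Wuthrich2014] Thm. 16, §3, §5; Washington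
[Washington1997] §7.1, §13; Mazur–Wiles 1984; Ferrero–Washington 1979; Delbourgo 1998 (G)/(M).
-/

set_option autoImplicit false

noncomputable section

open scoped Classical MatrixGroups ModularForm

open CongruenceSubgroup WeierstrassCurve Literature.NumberTheory.EllipticCurves
  Literature.NumberTheory.EllipticCurves.ModularForms
  Literature.NumberTheory.EllipticCurves.GreenbergVatsal2000
  Literature.NumberTheory.GaloisRepresentations
  Summit.BirchSwinnertonDyer.Rank1Residual.X1.MuLambda

namespace Summit.BirchSwinnertonDyer.Rank1Residual.Additive.X3Branch

/-! ### §0 Algebra of `Λ = ℤ_p⟦T⟧`: unit content, `μ`, and the generator criterion -/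

section Algebra

variable {p : ℕ} [Fact p.Prime]

/-- **The generator criterion with unit content.** For `g ≠ 0` and `g·h` of unit content (so
`μ(g·h) = 0 ≤ μ(g)`), `(g·h) = (g)` as soon as `λ(g·h) ≤ λ(g)` — Greenberg–Vatsal's sentence (p. 4)
through `X1.MuLambda.span_eq_span_iff_mu_le_and_lam_le`. [cite: GreenbergVatsal2000, p. 4 (after Thm. (1.2))] -/
theorem span_mul_eq_span_of_hasUnitContent_of_lam_le {g h : IwasawaAlgebra p} (hg : g ≠ 0)
    (hμ : HasUnitContent (g * h)) (hlam : lam (g * h) ≤ lam g) :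
    Ideal.span ({g * h} : Set (IwasawaAlgebra p)) = Ideal.span {g} :=
  (span_eq_span_iff_mu_le_and_lam_le hg (X11a.ne_zero_of_hasUnitContent hμ) rfl).mpr
    ⟨by rw [X11a.mu_eq_zero_of_hasUnitContent hμ]; exact Nat.zero_le _, hlam⟩

/-- **Reading the analytic `μ = 0` certificate on `Λ`.** If `ι g' = C(u·ϖ)·B` with `u ∈ ℤ_pˣ` and
ONE coefficient of `ϖ·B` has norm `1`, then `g'` has unit content. [folklore] -/
theorem hasUnitContent_of_iota_eq {g' : IwasawaAlgebra p} {u : ℤ_[p]ˣ} {ϖ : ℚ}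
    {B : PowerSeries ℚ_[p]}
    (hι : iwasawaToPowerSeries p g' = PowerSeries.C (((u : ℤ_[p]) : ℚ_[p]) * (ϖ : ℚ_[p])) * B)
    (hμ : ∃ n, ‖PowerSeries.coeff n (PowerSeries.C (ϖ : ℚ_[p]) * B)‖ = 1) :
    HasUnitContent g' := by
  obtain ⟨n, hn⟩ := hμ
  rw [hasUnitContent_iff_exists_norm_coeff_map_eq_one]
  refine ⟨n, ?_⟩
  rw [hι, PowerSeries.coeff_C_mul, mul_assoc, norm_mul, ← PowerSeries.coeff_C_mul, hn, mul_one]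
  simp

end Algebra

/-! ### §1 The typed items on the branch `m = (p−1)/2` (nothing asserted) -/

section Typed

variable (V : WeierstrassCurve ℚ) [V.IsElliptic] [V.IsGloballyMinimal] (p : ℕ) [Fact p.Prime]

/-- **The `ω^{(p−1)/2}`-BRANCH MAIN CONJECTURE of a semistable `V` with REDUCIBLE `V[p]` — TYPED**
(the equality whose published half is Wuthrich 2014 Thm. 16 on the component `m = (p−1)/2`): in the
exact setting of `Wuthrich2014.thm16_halfEigenCharIdeal_dvd_cyclotomicPrime` at `(V, p)` — `p ≠ 2`,
`K = ℚ(√p*)`, `F = ℚ(ζ_p)`, the cyclotomic `κ`, `γ`, the newform `f`, the branch `B` of the parity of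
`m` for the reduction type of `V` at `p` (good ordinary / split / non-split), `V[p]` reducible, a
half-eigen dual datum `D` (`X_m`), `ϖ` the period ratio of that parity — the characteristic ideal is
GENERATED by an element `g'` with `ι g' = C(u·ϖ)·B`, `u ∈ ℤ_pˣ`. Equivalently (`Λ` a domain, `ι`
injective): `char X_m = (ϖ·B)` as ideals of `Λ ⊗ ℚ_p ∩ Λ`. Delbourgo's Main Conjecture (G)/(M) of
the additive twist `V ⊗ χ_{p*}` in the twist's clothing (AUDIT-X34-GORD R3/R9). OPEN; nothing
asserted. [cite: Wuthrich2014, Thm. 16 and §3 (pp. 390, 397)] [cite: GreenbergVatsal2000, (1.1) and p. 4] -/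
@[conjecture] def X3BranchMainConjectureAt : Prop :=
  ∀ (K : Type) [Field K] [NumberField K] [(galRange (K := ℚ) K).Normal]
    (F : Type) [Field F] [NumberField F] [IsCyclotomicExtension {p} ℚ F]
    [(galRange (K := ℚ) F).Normal]
    {κ : ZpExtension ℚ p} {γ : Field.absoluteGaloisGroup ℚ} {N : ℕ} [NeZero N]
    {f : CuspForm (Gamma0 N) 2} (B : PowerSeries ℚ_[p]),
    p ≠ 2 → Module.finrank ℚ K = 2 →
    (∃ θ : K, θ ^ 2 = algebraMap ℚ K ((-1) ^ (p / 2) * p)) →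
    ((IsOrdinaryAt V p ∧
        B = if Even (p / 2) then padicLFunctionBranch f ((unitRoot V p : ℤ_[p]) : ℚ_[p]) (p / 2)
          else padicLFunctionMinusBranch f ((unitRoot V p : ℤ_[p]) : ℚ_[p]) (p / 2)) ∨
      (V.HasSplitMultiplicativeReductionAtPrime p ∧
        B = if Even (p / 2) then padicLFunctionPlusBranchMult f (1 : ℚ_[p]) (p / 2)
          else padicLFunctionMinusBranchMult f (1 : ℚ_[p]) (p / 2)) ∨
      (V.HasMultiplicativeReductionAtPrime p ∧ ¬ V.HasSplitMultiplicativeReductionAtPrime p ∧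
        B = if Even (p / 2) then padicLFunctionPlusBranchMult f (-1 : ℚ_[p]) (p / 2)
          else padicLFunctionMinusBranchMult f (-1 : ℚ_[p]) (p / 2))) →
    ¬ V.HasIrreducibleModPGaloisRep p →
    κ.IsCyclotomic → κ.IsTopGenerator γ → IsCyclotomicVariable p γ →
    γ ∈ galRange (K := ℚ) K → γ ∈ galRange (K := ℚ) F → IsNewformOf V f →
    ∀ (D : V.EigenSelmerDualData p
        (κ.kerSubgroup ⊓ galRange (K := ℚ) K ⊓ galRange (K := ℚ) F) κ.kerSubgroup
        (fun g ↦ if g ∈ galRange (K := ℚ) K then 1 else -1) γ) (ϖ : ℚ),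
      (if Even (p / 2) then (ϖ : ℝ) * V.realPeriodRat = plusPeriod f
        else (ϖ : ℝ) * V.imaginaryPeriodRat = minusPeriod f) →
      Module.IsTorsion (IwasawaAlgebra p) D.X ∧
      ∃ g' : IwasawaAlgebra p, D.charIdeal = Ideal.span {g'} ∧ ∃ u : ℤ_[p]ˣ,
        iwasawaToPowerSeries p g' =
          PowerSeries.C (((u : ℤ_[p]) : ℚ_[p]) * (ϖ : ℚ_[p])) * B

/-- **GREENBERG–VATSAL ON THE BRANCH: the `λ`-equality — TYPED** (row T-c2x3's target
`X3BranchLambdaEq`). In the setting of `X3BranchMainConjectureAt V p`, for every generator `g` of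
`char X_m` and every factorisation `ι(g·h) = C(u·ϖ)·B` (the shape Wuthrich's Thm. 16 delivers), IF
both `g` and `g·h` have unit content (`μ_alg = μ_an = 0`, explicit binders — per-pair census bits, not
facts) THEN `λ(g·h) = λ(g)` (`λ_an = λ_alg`; `λ` = `X1.MuLambda.lam`). The branch-`m` analogue of
Greenberg–Vatsal's Thm. (1.3) in the reducible case — printed ONLY for the trivial branch (see the
module docstring's honest note). OPEN; nothing asserted.
[cite: GreenbergVatsal2000, Thm. (1.3) (p. 2) and p. 4] [cite: Wuthrich2014, Thm. 16 (p. 397)] -/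
@[conjecture] def X3BranchLambdaEqAt : Prop :=
  ∀ (K : Type) [Field K] [NumberField K] [(galRange (K := ℚ) K).Normal]
    (F : Type) [Field F] [NumberField F] [IsCyclotomicExtension {p} ℚ F]
    [(galRange (K := ℚ) F).Normal]
    {κ : ZpExtension ℚ p} {γ : Field.absoluteGaloisGroup ℚ} {N : ℕ} [NeZero N]
    {f : CuspForm (Gamma0 N) 2} (B : PowerSeries ℚ_[p]),
    p ≠ 2 → Module.finrank ℚ K = 2 →
    (∃ θ : K, θ ^ 2 = algebraMap ℚ K ((-1) ^ (p / 2) * p)) →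
    ((IsOrdinaryAt V p ∧
        B = if Even (p / 2) then padicLFunctionBranch f ((unitRoot V p : ℤ_[p]) : ℚ_[p]) (p / 2)
          else padicLFunctionMinusBranch f ((unitRoot V p : ℤ_[p]) : ℚ_[p]) (p / 2)) ∨
      (V.HasSplitMultiplicativeReductionAtPrime p ∧
        B = if Even (p / 2) then padicLFunctionPlusBranchMult f (1 : ℚ_[p]) (p / 2)
          else padicLFunctionMinusBranchMult f (1 : ℚ_[p]) (p / 2)) ∨
      (V.HasMultiplicativeReductionAtPrime p ∧ ¬ V.HasSplitMultiplicativeReductionAtPrime p ∧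
        B = if Even (p / 2) then padicLFunctionPlusBranchMult f (-1 : ℚ_[p]) (p / 2)
          else padicLFunctionMinusBranchMult f (-1 : ℚ_[p]) (p / 2))) →
    ¬ V.HasIrreducibleModPGaloisRep p →
    κ.IsCyclotomic → κ.IsTopGenerator γ → IsCyclotomicVariable p γ →
    γ ∈ galRange (K := ℚ) K → γ ∈ galRange (K := ℚ) F → IsNewformOf V f →
    ∀ (D : V.EigenSelmerDualData p
        (κ.kerSubgroup ⊓ galRange (K := ℚ) K ⊓ galRange (K := ℚ) F) κ.kerSubgroup
        (fun g ↦ if g ∈ galRange (K := ℚ) K then 1 else -1) γ) (ϖ : ℚ),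
      (if Even (p / 2) then (ϖ : ℝ) * V.realPeriodRat = plusPeriod f
        else (ϖ : ℝ) * V.imaginaryPeriodRat = minusPeriod f) →
      ∀ (g h : IwasawaAlgebra p), D.charIdeal = Ideal.span {g} →
        (∃ u : ℤ_[p]ˣ, iwasawaToPowerSeries p (g * h) =
          PowerSeries.C (((u : ℤ_[p]) : ℚ_[p]) * (ϖ : ℚ_[p])) * B) →
        HasUnitContent g → HasUnitContent (g * h) → lam (g * h) = lam g

/-- **The analytic `μ = 0` bit on the branch — TYPED as a certificate** (per-pair census datum, to
be delivered by a `λ/μ` engine on `E♭ ⊗ ω^{(p−1)/2}`; instrument I-10 of CLASS-CLOSURE-PLAN §2.1):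
for the branch `B` of the newform `f` of `V` (reduction-type disjunction as in Wuthrich's fact) and
the period ratio `ϖ` of the matching parity, ONE coefficient of `ϖ·B` has `p`-adic norm `1`
(`μ(ϖ B) = 0`; with Wuthrich's `ι g' = C(uϖ)B` it is `HasUnitContent g'`,
`hasUnitContent_of_iota_eq`). Nothing asserted. [cite: GreenbergVatsal2000, p. 2, (1)–(2)] -/
def X3BranchAnalyticMuZeroAt : Prop :=
  ∀ {N : ℕ} [NeZero N] (f : CuspForm (Gamma0 N) 2) (B : PowerSeries ℚ_[p]) (ϖ : ℚ),
    ((IsOrdinaryAt V p ∧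
        B = if Even (p / 2) then padicLFunctionBranch f ((unitRoot V p : ℤ_[p]) : ℚ_[p]) (p / 2)
          else padicLFunctionMinusBranch f ((unitRoot V p : ℤ_[p]) : ℚ_[p]) (p / 2)) ∨
      (V.HasSplitMultiplicativeReductionAtPrime p ∧
        B = if Even (p / 2) then padicLFunctionPlusBranchMult f (1 : ℚ_[p]) (p / 2)
          else padicLFunctionMinusBranchMult f (1 : ℚ_[p]) (p / 2)) ∨
      (V.HasMultiplicativeReductionAtPrime p ∧ ¬ V.HasSplitMultiplicativeReductionAtPrime p ∧
        B = if Even (p / 2) then padicLFunctionPlusBranchMult f (-1 : ℚ_[p]) (p / 2)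
          else padicLFunctionMinusBranchMult f (-1 : ℚ_[p]) (p / 2))) →
    IsNewformOf V f →
    (if Even (p / 2) then (ϖ : ℝ) * V.realPeriodRat = plusPeriod f
      else (ϖ : ℝ) * V.imaginaryPeriodRat = minusPeriod f) →
    ∃ n, ‖PowerSeries.coeff n (PowerSeries.C (ϖ : ℚ_[p]) * B)‖ = 1

end Typed

/-! ### §2 The kernel equivalence on the branch, granted Wuthrich's half-eigen divisibility -/

section Kernel

variable {V : WeierstrassCurve ℚ} [V.IsElliptic] [V.IsGloballyMinimal] {p : ℕ} [Fact p.Prime]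

/-- **Greenberg–Vatsal on the branch ∧ analytic `μ = 0` ⟹ the branch main conjecture**, granted the
PUBLISHED named fact Wuthrich 2014 Thm. 16 on the component `(p−1)/2` (`hW`). Proof (GV p. 4 on the
branch): Wuthrich gives `g' = g·h ∈ char X_m = (g)` with `ι g' = C(uϖ)B`; the analytic `μ`-bit makes
`g'` of unit content, hence `g` too and `μ(g') = 0 ≤ μ(g)`; the typed `λ`-equality gives
`λ(g') ≤ λ(g)`; so `h ∈ Λˣ` and `char X_m = (g')` (`span_mul_eq_span_of_hasUnitContent_of_lam_le`).
NOT a class theorem (two typed inputs). [cite: GreenbergVatsal2000, p. 4 (after Thm. (1.2))]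
[cite: Wuthrich2014, Thm. 16 (p. 397)] -/
theorem x3BranchMainConjectureAt_of_lambdaEq_of_muZero
    (hW : Wuthrich2014.thm16_halfEigenCharIdeal_dvd_cyclotomicPrime)
    (hlam : X3BranchLambdaEqAt V p) (hμ : X3BranchAnalyticMuZeroAt V p) :
    X3BranchMainConjectureAt V p := by
  intro K _ _ _ F _ _ _ _ κ γ N _ f B hp2 h2 hθ hred hirr hκ hγ hcyc hγK hγF hf D ϖ hϖ
  obtain ⟨htors, g', hg'mem, u, hι⟩ :=
    hW p V K F B hp2 h2 hθ hred hirr hκ hγ hcyc hγK hγF hf D ϖ hϖ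
  refine ⟨htors, ?_⟩
  -- `char X_m = (g)` is principal; `g' = g·h`
  obtain ⟨g, hg⟩ := (charIdeal_isPrincipal_holds p D.X).principal
  have hchar : D.charIdeal = Ideal.span {g} := hg
  have hdvd : g ∣ g' := by
    rw [hchar] at hg'mem
    exact Ideal.mem_span_singleton.mp hg'mem
  obtain ⟨h, hfac⟩ := hdvd
  subst hfac
  -- the analytic `μ = 0` bit ⟹ unit content of `g·h`, hence of `g`
  have hμan : HasUnitContent (g * h) := hasUnitContent_of_iota_eq hι (hμ f B ϖ hred hf hϖ)
  have hμalg : HasUnitContent g := X11a.hasUnitContent_left_of_mul hμan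
  -- the `λ`-equality (typed) ⟹ `(g·h) = (g)`
  have hlam' : lam (g * h) = lam g :=
    hlam K F B hp2 h2 hθ hred hirr hκ hγ hcyc hγK hγF hf D ϖ hϖ g h hchar ⟨u, hι⟩ hμalg hμan
  refine ⟨g * h, hchar.trans ?_, u, hι⟩
  exact (span_mul_eq_span_of_hasUnitContent_of_lam_le (X11a.ne_zero_of_hasUnitContent hμalg) hμan
    hlam'.le).symm

omit [V.IsElliptic] in
/-- **Conversely, the branch main conjecture FORCES the `λ`-equality** (and needs no `μ`-bit): two
elements `g·h` and `g'` of `Λ` with `ι(g·h) = C(u'ϖ)B`, `ι(g') = C(uϖ)B` differ by the unit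
`u'u⁻¹ ∈ ℤ_pˣ` (`ι` injective), so `(g·h) = (g') = char X_m = (g)` and `λ`, `μ` agree
(`X1.MuLambda.span_eq_span_iff_mu_lam`). So `X3BranchLambdaEqAt` is exactly the `λ`-content of the
missing half. [cite: GreenbergVatsal2000, p. 4 (after Thm. (1.2))] -/
theorem x3BranchLambdaEqAt_of_mainConjecture (hMC : X3BranchMainConjectureAt V p) :
    X3BranchLambdaEqAt V p := by
  intro K _ _ _ F _ _ _ _ κ γ N _ f B hp2 h2 hθ hred hirr hκ hγ hcyc hγK hγF hf D ϖ hϖ g h hchar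
    hfac hμg hμgh
  obtain ⟨u', hι'⟩ := hfac
  obtain ⟨-, g', hchar', u, hι⟩ := hMC K F B hp2 h2 hθ hred hirr hκ hγ hcyc hγK hγF hf D ϖ hϖ
  -- `g·h = C(u'·u⁻¹)·g'`
  set w : ℤ_[p]ˣ := u' * u⁻¹ with hw
  have hscal : (((w : ℤ_[p]) : ℚ_[p])) * ((((u : ℤ_[p]) : ℚ_[p])) * (ϖ : ℚ_[p])) =
      (((u' : ℤ_[p]) : ℚ_[p])) * (ϖ : ℚ_[p]) := by
    have hu : (((w : ℤ_[p]) : ℚ_[p])) * (((u : ℤ_[p]) : ℚ_[p])) = (((u' : ℤ_[p]) : ℚ_[p])) := by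
      rw [← PadicInt.coe_mul, hw, Units.val_mul, mul_assoc, Units.inv_mul, mul_one]
    rw [← mul_assoc, hu]
  have heq : g * h = PowerSeries.C (w : ℤ_[p]) * g' := by
    apply iwasawaToPowerSeries_injective p
    have hC : iwasawaToPowerSeries p (PowerSeries.C (w : ℤ_[p])) =
        PowerSeries.C (((w : ℤ_[p]) : ℚ_[p])) := by
      simp [iwasawaToPowerSeries]
    calc iwasawaToPowerSeries p (g * h)
        = PowerSeries.C ((((u' : ℤ_[p]) : ℚ_[p])) * (ϖ : ℚ_[p])) * B := hι'
      _ = PowerSeries.C (((w : ℤ_[p]) : ℚ_[p])) *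
            (PowerSeries.C ((((u : ℤ_[p]) : ℚ_[p])) * (ϖ : ℚ_[p])) * B) := by
          rw [← mul_assoc, ← map_mul, hscal]
      _ = iwasawaToPowerSeries p (PowerSeries.C (w : ℤ_[p]) * g') := by
          rw [RingHom.map_mul (iwasawaToPowerSeries p) (PowerSeries.C (w : ℤ_[p])) g', hC, hι]
  have hCw : IsUnit (PowerSeries.C (w : ℤ_[p]) : IwasawaAlgebra p) := w.isUnit.map PowerSeries.C
  have hspan' : Ideal.span ({g * h} : Set (IwasawaAlgebra p)) = Ideal.span {g'} := by
    rw [heq]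
    exact Ideal.span_singleton_eq_span_singleton.mpr (associated_unit_mul_left g' _ hCw)
  have hspan : Ideal.span ({g * h} : Set (IwasawaAlgebra p)) = Ideal.span {g} := by
    rw [hspan', ← hchar', hchar]
  have hg : g ≠ 0 := X11a.ne_zero_of_hasUnitContent hμg
  have hgh : g * h ≠ 0 := X11a.ne_zero_of_hasUnitContent hμgh
  exact ((span_eq_span_iff_mu_lam hg hgh rfl).mp hspan).2

omit [V.IsElliptic] in
/-- **The reversed divisibility on the branch** (row T-c2's `QuadraticBranchLowerDivisibility`
shape for the REDUCIBLE twist): under the branch main conjecture, every element of `char X_m` is a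
multiple of an element `g'` with `ι g' = C(uϖ)·B`, for every half-eigen datum. Row T-c2 (seat p10)
takes this to the `T = 0` lower inputs of rows T-N10-low / T-N10b / T-N10M and to
`Typed.MissingLowerBoundAt` for the additive twist (NOT re-derived here). Bookkeeping.
[cite: Wuthrich2014, Thm. 16 (p. 397)] [cite: GreenbergVatsal2000, (1.1)] -/
theorem exists_generator_dvd_of_x3BranchMainConjectureAt (hMC : X3BranchMainConjectureAt V p)
    (K : Type) [Field K] [NumberField K] [(galRange (K := ℚ) K).Normal]
    (F : Type) [Field F] [NumberField F] [IsCyclotomicExtension {p} ℚ F]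
    [(galRange (K := ℚ) F).Normal]
    {κ : ZpExtension ℚ p} {γ : Field.absoluteGaloisGroup ℚ} {N : ℕ} [NeZero N]
    {f : CuspForm (Gamma0 N) 2} (B : PowerSeries ℚ_[p])
    (hp2 : p ≠ 2) (h2 : Module.finrank ℚ K = 2)
    (hθ : ∃ θ : K, θ ^ 2 = algebraMap ℚ K ((-1) ^ (p / 2) * p))
    (hred : (IsOrdinaryAt V p ∧
        B = if Even (p / 2) then padicLFunctionBranch f ((unitRoot V p : ℤ_[p]) : ℚ_[p]) (p / 2)
          else padicLFunctionMinusBranch f ((unitRoot V p : ℤ_[p]) : ℚ_[p]) (p / 2)) ∨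
      (V.HasSplitMultiplicativeReductionAtPrime p ∧
        B = if Even (p / 2) then padicLFunctionPlusBranchMult f (1 : ℚ_[p]) (p / 2)
          else padicLFunctionMinusBranchMult f (1 : ℚ_[p]) (p / 2)) ∨
      (V.HasMultiplicativeReductionAtPrime p ∧ ¬ V.HasSplitMultiplicativeReductionAtPrime p ∧
        B = if Even (p / 2) then padicLFunctionPlusBranchMult f (-1 : ℚ_[p]) (p / 2)
          else padicLFunctionMinusBranchMult f (-1 : ℚ_[p]) (p / 2)))
    (hirr : ¬ V.HasIrreducibleModPGaloisRep p)
    (hκ : κ.IsCyclotomic) (hγ : κ.IsTopGenerator γ) (hcyc : IsCyclotomicVariable p γ)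
    (hγK : γ ∈ galRange (K := ℚ) K) (hγF : γ ∈ galRange (K := ℚ) F) (hf : IsNewformOf V f)
    (D : V.EigenSelmerDualData p
        (κ.kerSubgroup ⊓ galRange (K := ℚ) K ⊓ galRange (K := ℚ) F) κ.kerSubgroup
        (fun g ↦ if g ∈ galRange (K := ℚ) K then 1 else -1) γ) (ϖ : ℚ)
    (hϖ : if Even (p / 2) then (ϖ : ℝ) * V.realPeriodRat = plusPeriod f
        else (ϖ : ℝ) * V.imaginaryPeriodRat = minusPeriod f) :
    ∃ g' : IwasawaAlgebra p, (∃ u : ℤ_[p]ˣ, iwasawaToPowerSeries p g' =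
        PowerSeries.C (((u : ℤ_[p]) : ℚ_[p]) * (ϖ : ℚ_[p])) * B) ∧
      ∀ x ∈ D.charIdeal, g' ∣ x := by
  obtain ⟨-, g', hchar', u, hι⟩ := hMC K F B hp2 h2 hθ hred hirr hκ hγ hcyc hγK hγF hf D ϖ hϖ
  refine ⟨g', ⟨u, hι⟩, fun x hx => ?_⟩
  rw [hchar'] at hx
  exact Ideal.mem_span_singleton.mp hx

/-- **Summary: on the branch, granted Wuthrich's half and the analytic `μ = 0` bit, the missing half
IS the `λ`-equality** (`X3BranchMainConjectureAt ↔ X3BranchLambdaEqAt`). The kernel form of the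
lead's T-c2 (iv): what X3 ∩ SubSemistableTwist lacks, beyond a per-pair `μ`-certificate, is
Greenberg–Vatsal's `λ`-computation ON THE BRANCH. [cite: GreenbergVatsal2000, p. 4] [cite: Wuthrich2014, Thm. 16] -/
theorem x3BranchMainConjectureAt_iff_lambdaEq_of_muZero
    (hW : Wuthrich2014.thm16_halfEigenCharIdeal_dvd_cyclotomicPrime)
    (hμ : X3BranchAnalyticMuZeroAt V p) :
    X3BranchMainConjectureAt V p ↔ X3BranchLambdaEqAt V p :=
  ⟨x3BranchLambdaEqAt_of_mainConjecture,
    fun hlam => x3BranchMainConjectureAt_of_lambdaEq_of_muZero hW hlam hμ⟩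

end Kernel

end Summit.BirchSwinnertonDyer.Rank1Residual.Additive.X3Branch

end
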